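import Summits.Ventures.CertifiedArithmetic.LowPrec.SRPythagorasLiabilityWindows
import HarnessLib

/-!
# CXXII — The liability potential (III): the two-point inequality on a two-run window — top/top,
# exact/exact, exact/top, the diagonal, fine/fine

HONEST FRAMING: certified error envelopes and provably optimal rounding/accumulation schemes for
low-precision formats under stated cost models; every table by two implementations; no hardware or
vendor claims.

Third file of the liability series (CXX accounting theorem, CXXI residue arithmetic and two-run
windows).  For a two-run window `hW : TwoRunWindow F lo mid hi g i J` with `0 ≤ lo` and StochasticA with
`N` random bits (`G = 2^J·g`, `E = G/2^N`, `f = 2^i·g`), the two-point inequality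
`PairLE F (probAwayA N) G E c c'` of CXX is proved in the cases
* `pairLE_top_top` — both points in the top run: all four children lie on the top lattice
  `mid + G·ℤ ⊆ mid + E·ℤ`, their liability vanishes (`pairLiab_eq_zero_of_grid`), both truncations read
  the same base point modulo `E`, and cost domination (`costdom`) makes the right side nonnegative;
* `pairLE_exact_exact` — two representable points (children = the points);
* `pairLE_exact_top` — a representable point below a point of the top run (cost domination in the
  sharp form against `⌊c̄'⌋`);
* `pairLE_self` — the DIAGONAL `c = c'` (the two independent roundings of one point): the children owe
  `2π(1−π)·w·((−w) mod E)`, zero unless the cell is a fine cell narrower than `E`, and then covered by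
  the point's unused variance and bias budgets — uses `N ≥ 1`;
* `pairLE_fine_fine` — two non-representable points of the fine run at a lattice separation `z·f`:
  same offset, same probability, same truncation; the inequality is CXXI's `ell3_le` with budget `G²`,
  funded by the variance slack `G²/4 − π(1−π)f²` — the ONE place where the length hypothesis
  `mid − lo ≤ 2^N·G` (fine run at most `2^N` top cells long) is used.
The remaining case fine/top, the assembly over all pairs and the law are CXXIII.  Exact, no `sorry`;
no claim beyond the stated case lemmas.  References: [ConnollyHighamMary2021], [ElararEtAl2025],
[FitzgibbonFelix2025].
-/

namespace Summit.Ventures.CertifiedArithmetic.LowPrec.SR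

open Literature.ComputerArithmetic.ConnollyHighamMary2021
open Finset

variable {K : Type*} [Field K] [LinearOrder K] [IsStrictOrderedRing K] [FloorRing K]

namespace LimitedBits

namespace TwoRunWindow

variable {F : Finset K} {lo mid hi g : K} {i J : ℕ}

/-! ### The two-point inequality on a two-run window: five cases -/

section Cases

variable (hW : TwoRunWindow F lo mid hi g i J) (hlo : 0 ≤ lo) (N : ℕ)
include hW hlo

/-- Both points in the top run (either order, or equal): every child is on the top lattice, the
children's liability vanishes, and the right side is nonnegative by cost domination. -/
theorem pairLE_top_top {c c' : K} (hc1 : mid ≤ c) (hc2 : c ≤ hi) (hc1' : mid ≤ c') (hc2' : c' ≤ hi) :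
    PairLE F (probAwayA N) (2 ^ J * g) (2 ^ J * g / 2 ^ N) c c' := by
  have hq01 : ∀ θ : K, 0 ≤ θ → θ ≤ 1 → 0 ≤ probAwayA N θ ∧ probAwayA N θ ≤ 1 :=
    fun θ h0 h1 => probAwayA_mem N θ h0 h1
  have hg := hW.nested.pos
  have hE : (0 : K) < 2 ^ J * g / 2 ^ N := by positivity
  have hGE : (2 : K) ^ J * g = 2 ^ N * (2 ^ J * g / 2 ^ N) := by field_simp
  obtain ⟨⟨z, hz⟩, hwc, hy, hmd, hdc, hcu, huh⟩ := hW.topData hlo N hc1 hc2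
  obtain ⟨⟨z', hz'⟩, hwc', hy', hmd', hdc', hcu', huh'⟩ := hW.topData hlo N hc1' hc2'
  -- lattice coordinates of the four children
  obtain ⟨zu, hzu⟩ : ∃ zu : ℤ, up F c - mid = zu * (2 ^ J * g) := by
    rcases hwc with h | h
    · exact ⟨z, by rw [h, hz]⟩
    · exact ⟨z + 1, by rw [h]; push_cast; linarith⟩
  obtain ⟨zu', hzu'⟩ : ∃ zu' : ℤ, up F c' - mid = zu' * (2 ^ J * g) := by
    rcases hwc' with h | h
    · exact ⟨z', by rw [h, hz']⟩
    · exact ⟨z' + 1, by rw [h]; push_cast; linarith⟩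
  have h0 : pairStepQ F (probAwayA N) (2 ^ J * g / 2 ^ N) c c' = 0 := by
    simp only [pairStepQ, stepQ]
    rw [pairLiab_eq_zero_of_grid hE N hGE hzu hzu', pairLiab_eq_zero_of_grid hE N hGE hzu hz',
      pairLiab_eq_zero_of_grid hE N hGE hz hzu', pairLiab_eq_zero_of_grid hE N hGE hz hz']
    ring
  -- nonnegativity of the right side
  have hwG : up F c - dn F c ≤ 2 ^ J * g := by
    rcases hwc with h | h
    · rw [h, sub_self]; positivity
    · rw [h]; linarith
  have hwG' : up F c' - dn F c' ≤ 2 ^ J * g := by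
    rcases hwc' with h | h
    · rw [h, sub_self]; positivity
    · rw [h]; linarith
  have hV := vslackQ_nonneg F hq01 (sub_nonneg.mpr (dn_le_up F c)) hwG
  have hV' := vslackQ_nonneg F hq01 (sub_nonneg.mpr (dn_le_up F c')) hwG'
  have hyb := resid_nonneg_lt (y := c - dn F c) hE
  have hyb' := resid_nonneg_lt (y := c' - dn F c') hE
  -- the two truncations read off the SAME base point modulo E
  have hdd : dn F c - dn F c' = ((z - z') * 2 ^ N : ℤ) * (2 ^ J * g / 2 ^ N) := by
    push_cast; linear_combination hz - hz' + ((z : K) - z') * hGE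
  have hyc : resid (c - dn F c') (2 ^ J * g / 2 ^ N) = resid (c - dn F c) (2 ^ J * g / 2 ^ N) := by
    rw [show c - dn F c' = (c - dn F c) + ((z - z') * 2 ^ N : ℤ) * (2 ^ J * g / 2 ^ N) by
      rw [← hdd]; ring, resid_add_mul hE]
  have hyc' : resid (c' - dn F c) (2 ^ J * g / 2 ^ N) = resid (c' - dn F c') (2 ^ J * g / 2 ^ N) := by
    rw [show c' - dn F c = (c' - dn F c') + ((z' - z) * 2 ^ N : ℤ) * (2 ^ J * g / 2 ^ N) by
      push_cast; linear_combination hz' - hz + ((z' : K) - z) * hGE, resid_add_mul hE]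
  unfold PairLE
  rw [h0, hy, hy']
  have hb := mul_nonneg hE.le (sub_nonneg.mpr hyb.2.le)
  have hb' := mul_nonneg hE.le (sub_nonneg.mpr hyb'.2.le)
  rcases le_total c c' with hcc | hcc
  · have hcd := costdom (D := dn F c') hE hcc (resid (c - dn F c) (2 ^ J * g / 2 ^ N))
    rw [hyc] at hcd
    simp only [sub_self, mul_zero] at hcd
    linarith [hcd, hV, hV', hb, hb']
  · have hcd := costdom (D := dn F c) hE hcc (resid (c' - dn F c') (2 ^ J * g / 2 ^ N))
    rw [hyc', pairLiab_comm] at hcd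
    simp only [sub_self, mul_zero] at hcd
    linarith [hcd, hV, hV', hb, hb']

omit hlo in
/-- Two representable points: the children are the points themselves. -/
theorem pairLE_exact_exact {c c' : K} (hc1 : lo ≤ c) (hc2 : c ≤ hi) (hc1' : lo ≤ c') (hc2' : c' ≤ hi)
    (he : up F c = dn F c) (he' : up F c' = dn F c') :
    PairLE F (probAwayA N) (2 ^ J * g) (2 ^ J * g / 2 ^ N) c c' := by
  have hg := hW.nested.pos
  have hE : (0 : K) < 2 ^ J * g / 2 ^ N := by positivity
  obtain ⟨-, hd, hu, hy, -⟩ := hW.exactData (probAwayA N) hc1 hc2 he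
  obtain ⟨-, hd', hu', hy', -⟩ := hW.exactData (probAwayA N) hc1' hc2' he'
  have h0 : pairStepQ F (probAwayA N) (2 ^ J * g / 2 ^ N) c c' = pairLiab (2 ^ J * g / 2 ^ N) c c' := by
    simp only [pairStepQ, stepQ]; rw [hd, hu, hd', hu']; ring
  unfold PairLE vslackQ
  rw [h0, hy, hy', hd, hu, hd', hu']
  nlinarith [hE]

/-- A representable point below a point of the top run. -/
theorem pairLE_exact_top {c c' : K} (hc1 : lo ≤ c) (hcc : c < c') (hc1' : mid ≤ c') (hc2' : c' ≤ hi)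
    (he : up F c = dn F c) :
    PairLE F (probAwayA N) (2 ^ J * g) (2 ^ J * g / 2 ^ N) c c' := by
  have hq01 : ∀ θ : K, 0 ≤ θ → θ ≤ 1 → 0 ≤ probAwayA N θ ∧ probAwayA N θ ≤ 1 :=
    fun θ h0 h1 => probAwayA_mem N θ h0 h1
  have hg := hW.nested.pos
  have hE : (0 : K) < 2 ^ J * g / 2 ^ N := by positivity
  have hGE : (2 : K) ^ J * g = 2 ^ N * (2 ^ J * g / 2 ^ N) := by field_simp
  have hc2 : c ≤ hi := hcc.le.trans hc2'
  obtain ⟨hcF, hd, hu, hy, -⟩ := hW.exactData (probAwayA N) hc1 hc2 he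
  obtain ⟨⟨z', hz'⟩, hwc', hy', hmd', hdc', hcu', huh'⟩ := hW.topData hlo N hc1' hc2'
  have hcd' : c ≤ dn F c' := le_dn_of_mem hcF hcc.le
  -- both children of c' read the same residue ψ = (c − ⌊c̄'⌋) mod E against c
  have hψb := resid_nonneg_lt (y := c - dn F c') hE
  have hres : resid (c - up F c') (2 ^ J * g / 2 ^ N) = resid (c - dn F c') (2 ^ J * g / 2 ^ N) := by
    rcases hwc' with h | h
    · rw [h]
    · rw [h, show c - (dn F c' + 2 ^ J * g) = (c - dn F c') + ((-(2 ^ N) : ℤ) : K)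
        * (2 ^ J * g / 2 ^ N) by push_cast; linear_combination (-1 : K) * hGE, resid_add_mul hE]
  have hlu : pairLiab (2 ^ J * g / 2 ^ N) c (up F c')
      = (up F c' - c) * resid (c - dn F c') (2 ^ J * g / 2 ^ N) := by
    unfold pairLiab
    rw [abs_of_nonpos (by linarith [dn_le_up F c']), neg_neg, hres]; ring
  have hld : pairLiab (2 ^ J * g / 2 ^ N) c (dn F c')
      = (dn F c' - c) * resid (c - dn F c') (2 ^ J * g / 2 ^ N) := by
    unfold pairLiab; rw [abs_of_nonpos (by linarith), neg_neg]; ring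
  have h0 : pairStepQ F (probAwayA N) (2 ^ J * g / 2 ^ N) c c'
      = (stepQ F (probAwayA N) c' (fun t => t) - c) * resid (c - dn F c') (2 ^ J * g / 2 ^ N) := by
    simp only [pairStepQ, stepQ]; rw [hd, hu, hlu, hld]; ring
  have hm' : stepQ F (probAwayA N) c' (fun t => t) = c' - truncQ F (probAwayA N) c' := by
    unfold truncQ; ring
  -- cost domination in the sharp form: ℓ(c,c') + (c − c')(0 − y') ≥ (c' − c)·ψ
  have hcd := costdom (D := dn F c') hE hcc.le (0 : K)
  rw [← hy'] at hcd
  have hyb' := resid_nonneg_lt (y := c' - dn F c') hE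
  rw [← hy'] at hyb'
  have hwG' : up F c' - dn F c' ≤ 2 ^ J * g := by
    rcases hwc' with h | h
    · rw [h, sub_self]; positivity
    · rw [h]; linarith
  have hV' := vslackQ_nonneg F hq01 (sub_nonneg.mpr (dn_le_up F c')) hwG'
  unfold PairLE
  rw [h0, hm', hy]
  unfold vslackQ at hV' ⊢
  rw [hu, hd]
  linarith [hcd, hV', mul_nonneg hyb'.1 hψb.1, mul_nonneg hE.le (sub_nonneg.mpr hyb'.2.le),
    sq_nonneg (2 ^ J * g), sq_nonneg (2 ^ J * g / 2 ^ N)]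

set_option maxHeartbeats 1600000 in
/-- The diagonal (a state paired with itself: the sibling pair of the next level). -/
theorem pairLE_self (hN : 1 ≤ N) {c : K} (hc1 : lo ≤ c) (hc2 : c ≤ hi) :
    PairLE F (probAwayA N) (2 ^ J * g) (2 ^ J * g / 2 ^ N) c c := by
  have hq01 : ∀ θ : K, 0 ≤ θ → θ ≤ 1 → 0 ≤ probAwayA N θ ∧ probAwayA N θ ≤ 1 :=
    fun θ h0 h1 => probAwayA_mem N θ h0 h1
  have hg := hW.nested.pos
  have hE : (0 : K) < 2 ^ J * g / 2 ^ N := by positivity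
  have hGE : (2 : K) ^ J * g = 2 ^ N * (2 ^ J * g / 2 ^ N) := by field_simp
  have h2N : (2 : K) ≤ 2 ^ N := by
    calc (2 : K) = 2 ^ 1 := by norm_num
      _ ≤ 2 ^ N := pow_le_pow_right₀ (by norm_num) hN
  obtain ⟨hp0, hp1⟩ := pUpQ_mem F hq01 c
  set w := up F c - dn F c with hw
  have hw0 : 0 ≤ w := sub_nonneg.mpr (dn_le_up F c)
  -- the pair step on the diagonal: 2π(1−π)·ℓ(⌊c̄⌋, ⌈c̄⌉) = 2π(1−π)·w·((−w) mod E)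
  have hdiag : pairStepQ F (probAwayA N) (2 ^ J * g / 2 ^ N) c c
      = 2 * (pUpQ F (probAwayA N) c * (1 - pUpQ F (probAwayA N) c))
        * (w * resid (-w) (2 ^ J * g / 2 ^ N)) := by
    simp only [pairStepQ, stepQ]
    rw [pairLiab_self, pairLiab_self, pairLiab_comm _ (dn F c)]
    unfold pairLiab; rw [abs_of_nonneg hw0]; ring
  -- the truncation is below E
  have hyE : 0 ≤ truncQ F (probAwayA N) c ∧ truncQ F (probAwayA N) c ≤ 2 ^ J * g / 2 ^ N := by
    unfold truncQ
    refine ⟨hW.nested.trunc_nonneg hlo N hc1 hc2, ?_⟩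
    by_cases he : up F c = dn F c
    · obtain ⟨-, -, -, -, hdc, hcu⟩ := hW.nested.cand hc1 hc2
      rw [trunc_eq_zero_of_exact F (probAwayA N) hdc hcu he]; exact hE.le
    · obtain ⟨j, hj, -, -, -, hlt⟩ := hW.nested.cellA hlo N hc1 hc2 he
      have : (2 : K) ^ j * g / 2 ^ N ≤ 2 ^ J * g / 2 ^ N :=
        div_le_div_of_nonneg_right (mul_le_mul_of_nonneg_right
          (pow_le_pow_right₀ (by norm_num) hj) hg.le) (by positivity)
      linarith
  -- the liability of the sibling pair: 0 unless the cell is a fine cell narrower than E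
  have h2E : 2 * (2 ^ J * g / 2 ^ N) ≤ 2 ^ J * g :=
    calc 2 * (2 ^ J * g / 2 ^ N) ≤ 2 ^ N * (2 ^ J * g / 2 ^ N) := mul_le_mul_of_nonneg_right h2N hE.le
      _ = 2 ^ J * g := hGE.symm
  have hL : 2 * (w * resid (-w) (2 ^ J * g / 2 ^ N)) + w ^ 2 ≤ (2 ^ J * g) ^ 2 := by
    by_cases he : up F c = dn F c
    · have : w = 0 := by rw [hw, he, sub_self]
      rw [this]; ring_nf; positivity
    · rcases le_or_gt mid c with hmc | hcm
      · have h := hW.top c hmc hc2 he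
        rw [← hw] at h
        rw [show -w = ((-(2 ^ N) : ℤ) : K) * (2 ^ J * g / 2 ^ N) by
          rw [h]; push_cast; linear_combination (-1 : K) * hGE, resid_int_mul hE, mul_zero, mul_zero,
          zero_add, h]
      · have h := hW.fine c hc1 hcm.le he
        rw [← hw] at h
        have hwG : w ≤ 2 ^ J * g := by
          rw [h]; exact mul_le_mul_of_nonneg_right (pow_le_pow_right₀ (by norm_num) hW.i_le) hg.le
        by_cases hwE : w < 2 ^ J * g / 2 ^ N
        · have hr : resid (-w) (2 ^ J * g / 2 ^ N) = 2 ^ J * g / 2 ^ N - w := by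
            rw [show -w = (2 ^ J * g / 2 ^ N - w) + ((-1 : ℤ) : K) * (2 ^ J * g / 2 ^ N) by
              push_cast; ring, resid_add_mul hE]
            exact resid_eq_self hE (by linarith) (by
              have : 0 < w := by rw [h]; positivity
              linarith)
          have hEG : (2 ^ J * g / 2 ^ N) ^ 2 ≤ (2 ^ J * g) ^ 2 := by nlinarith [h2E, hE]
          rw [hr]; nlinarith [sq_nonneg (2 ^ J * g / 2 ^ N - w), hEG]
        · -- a fine cell at least `E` wide is a multiple of `E`: no liability
          push Not at hwE
          have hiNJ : J ≤ i + N := by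
            by_contra hlt; push Not at hlt
            have h' : (2 : K) ^ J * g / 2 ^ N ≤ 2 ^ i * g := h ▸ hwE
            rw [div_le_iff₀ (by positivity)] at h'
            have : (2 : K) ^ i * g * 2 ^ N < 2 ^ J * g := by
              calc (2 : K) ^ i * g * 2 ^ N = 2 ^ (i + N) * g := by rw [pow_add]; ring
                _ < 2 ^ J * g := mul_lt_mul_of_pos_right (pow_lt_pow_right₀ (by norm_num) hlt) hg
            linarith
          obtain ⟨d, hd⟩ : ∃ d, i + N = J + d := ⟨i + N - J, by omega⟩
          have e2 : (2 : K) ^ i * g = 2 ^ d * (2 ^ J * g / 2 ^ N) := by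
            apply mul_right_cancel₀ (show (2 : K) ^ N ≠ 0 by positivity)
            calc (2 : K) ^ i * g * 2 ^ N = 2 ^ (i + N) * g := by rw [pow_add]; ring
              _ = 2 ^ (J + d) * g := by rw [hd]
              _ = 2 ^ d * (2 ^ N * (2 ^ J * g / 2 ^ N)) := by rw [pow_add, ← hGE]; ring
              _ = 2 ^ d * (2 ^ J * g / 2 ^ N) * 2 ^ N := by ring
          rw [show -w = ((-(2 ^ d) : ℤ) : K) * (2 ^ J * g / 2 ^ N) by rw [h, e2]; push_cast; ring,
            resid_int_mul hE, mul_zero, mul_zero, zero_add]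
          exact pow_le_pow_left₀ hw0 hwG 2
  unfold PairLE vslackQ
  rw [hdiag, pairLiab_self, ← hw]
  have hpq : pUpQ F (probAwayA N) c * (1 - pUpQ F (probAwayA N) c) ≤ 1 / 4 := by
    linarith [sq_nonneg (pUpQ F (probAwayA N) c - 1 / 2)]
  have hpq0 : 0 ≤ pUpQ F (probAwayA N) c * (1 - pUpQ F (probAwayA N) c) := mul_nonneg hp0 (by linarith)
  linarith [mul_le_mul_of_nonneg_left hL hpq0, mul_le_mul_of_nonneg_right hpq (sq_nonneg (2 ^ J * g)),
    mul_nonneg hE.le (sub_nonneg.mpr hyE.2), mul_nonneg hpq0 (sq_nonneg w)]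

set_option maxHeartbeats 1600000 in
/-- Two non-representable points of the fine run at a lattice separation: same offset, hence the
same probability and the same truncation; the inequality is `ell3_le`.  This is the case that
uses the length hypothesis `mid − lo ≤ 2^N·G`. -/
theorem pairLE_fine_fine (hlen : mid - lo ≤ 2 ^ N * (2 ^ J * g)) {c c' : K} (hc1 : lo ≤ c)
    (hcc : c < c') (hcm' : c' < mid) (hne : up F c ≠ dn F c) (hne' : up F c' ≠ dn F c') {z : ℤ}
    (hz : c' - c = z * (2 ^ i * g)) :
    PairLE F (probAwayA N) (2 ^ J * g) (2 ^ J * g / 2 ^ N) c c' := by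
  have hq01 : ∀ θ : K, 0 ≤ θ → θ ≤ 1 → 0 ≤ probAwayA N θ ∧ probAwayA N θ ≤ 1 :=
    fun θ h0 h1 => probAwayA_mem N θ h0 h1
  have hg := hW.nested.pos
  have hE : (0 : K) < 2 ^ J * g / 2 ^ N := by positivity
  have hGE : (2 : K) ^ J * g = 2 ^ N * (2 ^ J * g / 2 ^ N) := by field_simp
  have hf : (0 : K) < 2 ^ i * g := by positivity
  have hcm : c < mid := hcc.trans hcm'
  have hc1' : lo ≤ c' := hc1.trans hcc.le
  obtain ⟨hw, hy, hum, hlod, ⟨zd, hzd⟩, hdlt, hult, hπ⟩ := hW.fineData hlo N hc1 hcm hne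
  obtain ⟨hw', hy', hum', hlod', ⟨zd', hzd'⟩, hdlt', hult', hπ'⟩ := hW.fineData hlo N hc1' hcm' hne'
  -- the two offsets agree (both lie in `(0, f)` and differ by a multiple of `f`)
  have hoff : c' - dn F c' = c - dn F c := by
    have e : (c' - dn F c') - (c - dn F c) = ((z - (zd' - zd) : ℤ) : K) * (2 ^ i * g) := by
      push_cast; linear_combination hz - hzd' + hzd
    have k0 : (-1 : K) < ((z - (zd' - zd) : ℤ) : K) := by
      by_contra h; push Not at h
      have := mul_le_mul_of_nonneg_right h hf.le
      linarith
    have k1 : ((z - (zd' - zd) : ℤ) : K) < 1 := by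
      by_contra h; push Not at h
      have := mul_le_mul_of_nonneg_right h hf.le
      linarith
    have k0' : (-1 : ℤ) < z - (zd' - zd) := by exact_mod_cast k0
    have k1' : z - (zd' - zd) < (1 : ℤ) := by exact_mod_cast k1
    have h0 : z - (zd' - zd) = 0 := by omega
    rw [h0] at e; push_cast at e; linarith
  -- hence the same probability and the same truncation; `Δ := c' − c = ⌊c̄'⌋ − ⌊c̄⌋ ≥ f`
  have hpp : pUpQ F (probAwayA N) c' = pUpQ F (probAwayA N) c := by rw [hπ, hπ', hoff, hw, hw']
  have hyy : truncQ F (probAwayA N) c' = truncQ F (probAwayA N) c := by rw [hy, hy', hoff]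
  have hd' : dn F c' = dn F c + (c' - c) := by linarith
  have hu : up F c = dn F c + 2 ^ i * g := by linarith
  have hu' : up F c' = dn F c + (c' - c) + 2 ^ i * g := by linarith
  have hfΔ : 2 ^ i * g ≤ c' - c := by
    have e : c' - c = ((zd' - zd : ℤ) : K) * (2 ^ i * g) := by push_cast; linarith
    have k0 : (0 : K) < ((zd' - zd : ℤ) : K) := by
      by_contra h; push Not at h
      have := mul_le_mul_of_nonneg_right h hf.le
      linarith
    have k0' : (0 : ℤ) < zd' - zd := by exact_mod_cast k0
    have k1 : (1 : ℤ) ≤ zd' - zd := by omega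
    have k1' : (1 : K) ≤ ((zd' - zd : ℤ) : K) := by exact_mod_cast k1
    have := mul_le_mul_of_nonneg_right k1' hf.le
    linarith
  -- the pair step in terms of three liabilities
  have h0 : pairStepQ F (probAwayA N) (2 ^ J * g / 2 ^ N) c c'
      = (pUpQ F (probAwayA N) c * pUpQ F (probAwayA N) c
          + (1 - pUpQ F (probAwayA N) c) * (1 - pUpQ F (probAwayA N) c))
          * pairLiab (2 ^ J * g / 2 ^ N) (dn F c) (dn F c + (c' - c))
        + pUpQ F (probAwayA N) c * (1 - pUpQ F (probAwayA N) c)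
          * (pairLiab (2 ^ J * g / 2 ^ N) (dn F c + 2 ^ i * g) (dn F c + (c' - c))
            + pairLiab (2 ^ J * g / 2 ^ N) (dn F c) (dn F c + (c' - c) + 2 ^ i * g)) := by
    simp only [pairStepQ, stepQ]
    rw [hpp, hu, hu', hd', pairLiab_add_right]
    ring
  -- the liability of the pair itself is the base liability
  have hcc' : pairLiab (2 ^ J * g / 2 ^ N) c c'
      = pairLiab (2 ^ J * g / 2 ^ N) (dn F c) (dn F c + (c' - c)) := by
    unfold pairLiab; rw [show dn F c - (dn F c + (c' - c)) = c - c' by ring]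
  -- the three-liability inequality with budget `G²`
  have hfG : (2 : K) ^ i * g ≤ 2 ^ J * g :=
    mul_le_mul_of_nonneg_right (pow_le_pow_right₀ (by norm_num) hW.i_le) hg.le
  have hB : (c' - c + 2 ^ i * g) * (2 ^ J * g / 2 ^ N) ≤ (2 ^ J * g) ^ 2 := by
    have h1 : c' - c + 2 ^ i * g ≤ 2 ^ N * (2 ^ J * g) := by linarith
    calc (c' - c + 2 ^ i * g) * (2 ^ J * g / 2 ^ N) ≤ 2 ^ N * (2 ^ J * g) * (2 ^ J * g / 2 ^ N) :=
          mul_le_mul_of_nonneg_right h1 hE.le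
      _ = (2 ^ J * g) ^ 2 := by field_simp
  have hfB : (2 ^ i * g) ^ 2 ≤ (2 ^ J * g) ^ 2 := pow_le_pow_left₀ hf.le hfG 2
  have hS := ell3_le hE hf hfΔ hz (dyadic_split hg i J N) hB hfB (dn F c)
  -- explicit variance slacks, probability bounds, truncation below `E`
  have hVc : vslackQ F (probAwayA N) (2 ^ J * g) c = (2 ^ J * g) ^ 2 / 4
      - pUpQ F (probAwayA N) c * (1 - pUpQ F (probAwayA N) c) * (2 ^ i * g) ^ 2 := by
    unfold vslackQ; rw [hw]
  have hVc' : vslackQ F (probAwayA N) (2 ^ J * g) c' = (2 ^ J * g) ^ 2 / 4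
      - pUpQ F (probAwayA N) c * (1 - pUpQ F (probAwayA N) c) * (2 ^ i * g) ^ 2 := by
    unfold vslackQ; rw [hw', hpp]
  obtain ⟨hp0, hp1⟩ := pUpQ_mem F hq01 c
  have hpq : pUpQ F (probAwayA N) c * (1 - pUpQ F (probAwayA N) c) ≤ 1 / 4 := by
    linarith [sq_nonneg (pUpQ F (probAwayA N) c - 1 / 2)]
  have hpq0 : 0 ≤ pUpQ F (probAwayA N) c * (1 - pUpQ F (probAwayA N) c) :=
    mul_nonneg hp0 (by linarith)
  have hyb := resid_nonneg_lt (y := c - dn F c) (show (0 : K) < 2 ^ i * g / 2 ^ N by positivity)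
  rw [← hy] at hyb
  have hufE : (2 : K) ^ i * g / 2 ^ N ≤ 2 ^ J * g / 2 ^ N :=
    div_le_div_of_nonneg_right hfG (by positivity)
  have F1 := mul_le_mul_of_nonneg_left hS hpq0
  have F2 := mul_le_mul_of_nonneg_right hpq (sq_nonneg (2 ^ J * g))
  have F3 := mul_nonneg hE.le (show 0 ≤ 2 ^ J * g / 2 ^ N - truncQ F (probAwayA N) c by
    linarith only [hyb.2, hufE])
  unfold PairLE
  rw [h0, hcc', hyy, hVc, hVc']
  linarith only [F1, F2, F3]

end Cases

end TwoRunWindow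

end LimitedBits

end Summit.Ventures.CertifiedArithmetic.LowPrec.SR
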